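import Summits.AnomalousDissipation.AnomalousDissipation.Theorems.TwoAndHalfDTwohalfdNegQuietOfSubLog
import Literature.Analysis.FluidPDE.LongTimeAverageSlidingWindow

/-!
# Stub `stub_quietOfSubLogGrid` (S5', grid form of S5) of the line
# `log-kantorovich-enstrophy-transfer` (crux stmt-AnomalousDissipation-0211, `TwoAndHalfD.TwohalfdNeg`)

**Below `o(log(1/ν))` mean planar strain, GRID releases are finite-window quiet.** This is the
landed continuum stub `QuietOfSubLog.stub_quietOfSubLog` (`Theorems/TwoAndHalfDTwohalfdNegQuietOfSubLog.lean`)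
with releases at the grid times `s_n = δ(n+1)`, `n : ℕ`, and quietness measured by the `limsup` over
`N : ℕ` of the discrete Cesàro means `N⁻¹ Σ_{n<N} D_j(n)`, `D_j(n) = (ν_j ∫₀^S ‖∇ϑ_{j,n}‖²).toReal`
— the form consumed by the reshaped age-decoupling stub `stub_ageDecouplingGrid`.

Proof (pure bookkeeping over the landed kit).
1. Per release (`QuietOfSubLog.toReal_eScalarDissipation_release_le`, release time `s_n > 0`): for
   `ν ≤ κ₀`, `D(n) ≤ (C/ℓ)(W(n) + 1)`, `ℓ = log(1/ν) > 0`,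
   `W(n) = (∫⁻_{(0,S+1)} (‖∇v(s_n + τ)‖₂²)^{1/2} dτ).toReal` (window strain over `(s_n, s_n + S + 1)`).
2. Discrete sliding window (`mul_sum_lintegral_window_le`): the window at `s_n` is contained in the
   window of length `S + 1 + δ` at every `s ∈ (δn, δ(n+1)]`, so
   `δ Σ_{n<N} W(n) ≤ ∫₀^{δN} W_{S+1+δ}(s) ds ≤ (S+1+δ) ∫₀^{δN+S+1+δ} ‖∇v‖₂`
   (the continuum sliding-window bound `lintegral_window_le_of_aemeasurable`), i.e.
   `N⁻¹ Σ_{n<N} W(n) ≤ ((S+1+δ)/δ) · (T_N/N) · ⟨‖∇v‖₂⟩_{T_N}`, `T_N = δN + S + 1 + δ`.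
3. `limsup` over `N`: eventually `T_N/N ≤ 2δ` and `⟨‖∇v‖₂⟩_{T_N} ≤ Ψ + 1`, `Ψ = ⟨‖∇v‖₂⟩` the honest
   `limsup` mean strain (`T_N → ∞`; the running means are bounded at fixed `ν`,
   `QuietOfSubLog.isBoundedUnder_timeMean_sqrt_eGradNormSq`), whence
   `limsup_N N⁻¹ Σ_{n<N} D(n) ≤ (C/ℓ)(2(S+1+δ)(Ψ+1) + 1)` (`limsup_cesaro_release_le`).
4. `j → ∞`: `Ψ_j/ℓ_j → 0` (hypothesis), `1/ℓ_j → 0` (`ν_j → 0⁺`); squeeze with the nonnegativity of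
   the Cesàro means.

References: skeleton `Cruxes/TwohalfdNeg/Lines/log_kantorovich_enstrophy_transfer.lean` (S5');
Doering–Foias, J. Fluid Mech. 467 (2002) §2 (running means).
-/

-- `Summit.<Summit>.<Problem>` is the tree's mandated summit-side namespace (CONVENTIONS §2); for this
-- single-conjunct summit the two coincide, so the duplicate is deliberate.
set_option linter.dupNamespace false

noncomputable section

namespace Summit.AnomalousDissipation.AnomalousDissipation.Theorems.TwohalfdNeg.QuietOfSubLogGrid

open MeasureTheory Filter Topology
open scoped ENNReal NNReal
open Literature.Analysis.FunctionSpaces Literature.Analysis.FluidPDE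
open Summit.AnomalousDissipation.AnomalousDissipation.Theorems.TwohalfdNeg.QuietOfSubLog

/-! ## The discrete sliding window -/

section SlidingWindow

open Set

/-- Lower integrals over the adjacent cells `(δn, δ(n+1)]`, `n < N`, add up to the lower integral
over `(0, δN]` (`δ ≥ 0`). [folklore] -/
theorem sum_setLIntegral_Ioc_eq (G : ℝ → ℝ≥0∞) {δ : ℝ} (hδ : 0 ≤ δ) (N : ℕ) :
    ∑ n ∈ Finset.range N, ∫⁻ s in Ioc (δ * n) (δ * (n + 1)), G s =
      ∫⁻ s in Ioc 0 (δ * N), G s := by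
  induction N with
  | zero => simp
  | succ N ih =>
    rw [Finset.sum_range_succ, ih, Nat.cast_succ,
      ← lintegral_union measurableSet_Ioc (Ioc_disjoint_Ioc_of_le le_rfl), Ioc_union_Ioc_eq_Ioc]
    · exact mul_nonneg hδ N.cast_nonneg
    · exact mul_le_mul_of_nonneg_left (by linarith) hδ

/-- **Discrete sliding-window bound.** For `φ : ℝ → [0, ∞]` a.e.-measurable on `(0, ∞)`, a window
length `c`, a mesh `δ > 0` and `N : ℕ`:
`δ · Σ_{n<N} ∫⁻_{(0,c)} φ(δ(n+1) + τ) dτ ≤ (c + δ) · ∫⁻_{(0, δN + c + δ)} φ`. The window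
`(δ(n+1), δ(n+1) + c)` is contained in `(s, s + c + δ)` for every `s` in the cell `(δn, δ(n+1)]` of
length `δ`; integrate over the cell, add the cells up to `(0, δN]`, and apply the continuum
sliding-window bound `lintegral_window_le_of_aemeasurable` with window `c + δ`. [folklore] -/
theorem mul_sum_lintegral_window_le {φ : ℝ → ℝ≥0∞}
    (hφ : AEMeasurable φ (volume.restrict (Ioi 0))) (c : ℝ) {δ : ℝ} (hδ : 0 < δ) (N : ℕ) :
    ENNReal.ofReal δ * ∑ n ∈ Finset.range N, ∫⁻ τ in Ioo 0 c, φ (δ * (n + 1) + τ) ≤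
      ENNReal.ofReal (c + δ) * ∫⁻ t in Ioo 0 (δ * N + (c + δ)), φ t := by
  set G : ℝ → ℝ≥0∞ := fun s => ∫⁻ τ in Ioo 0 (c + δ), φ (s + τ) with hG
  have hcell : ∀ n : ℕ, ENNReal.ofReal δ * ∫⁻ τ in Ioo 0 c, φ (δ * (n + 1) + τ) ≤
      ∫⁻ s in Ioc (δ * n) (δ * (n + 1)), G s := fun n => by
    have hvol : volume (Ioc (δ * n) (δ * (n + 1)) : Set ℝ) = ENNReal.ofReal δ := by
      rw [Real.volume_Ioc]
      congr 1
      ring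
    have hsn : δ * ((n : ℝ) + 1) = δ * n + δ := by ring
    calc ENNReal.ofReal δ * ∫⁻ τ in Ioo 0 c, φ (δ * (n + 1) + τ)
        = ∫⁻ _ in Ioc (δ * n) (δ * (n + 1)), ∫⁻ τ in Ioo 0 c, φ (δ * (n + 1) + τ) := by
          rw [setLIntegral_const, hvol, mul_comm]
      _ ≤ ∫⁻ s in Ioc (δ * n) (δ * (n + 1)), G s := by
          refine setLIntegral_mono' measurableSet_Ioc fun s hs => ?_
          simp only [hG]
          rw [setLIntegral_Ioo_add_left φ 0 c, setLIntegral_Ioo_add_left φ 0 (c + δ)]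
          exact lintegral_mono_set
            (Ioo_subset_Ioo (by linarith [hs.2]) (by linarith [hs.1]))
  calc ENNReal.ofReal δ * ∑ n ∈ Finset.range N, ∫⁻ τ in Ioo 0 c, φ (δ * (n + 1) + τ)
      = ∑ n ∈ Finset.range N, ENNReal.ofReal δ * ∫⁻ τ in Ioo 0 c, φ (δ * (n + 1) + τ) :=
        Finset.mul_sum _ _ _
    _ ≤ ∑ n ∈ Finset.range N, ∫⁻ s in Ioc (δ * n) (δ * (n + 1)), G s :=
        Finset.sum_le_sum fun n _ => hcell n
    _ = ∫⁻ s in Ioo 0 (δ * N), G s := by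
        rw [sum_setLIntegral_Ioc_eq G hδ.le N, restrict_Ioo_eq_restrict_Ioc]
    _ ≤ ENNReal.ofReal (c + δ) * ∫⁻ t in Ioo 0 (δ * N + (c + δ)), φ t :=
        lintegral_window_le_of_aemeasurable hφ (c + δ) (δ * N)

/-- **Discrete sliding-window bound, real form.** Under the hypotheses of
`mul_sum_lintegral_window_le`, `c ≥ 0`, and `∫⁻_{(0,T)} φ < ∞` for `T = δN + c + δ`:
`Σ_{n<N} (∫⁻_{(0,c)} φ(δ(n+1) + τ) dτ).toReal ≤ ((c + δ)/δ) · T · ⟨φ.toReal⟩_T` (`timeMean`). [folklore] -/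
theorem sum_toReal_window_le {φ : ℝ → ℝ≥0∞} (hφ : AEMeasurable φ (volume.restrict (Ioi 0)))
    {c δ : ℝ} (hc : 0 ≤ c) (hδ : 0 < δ) (N : ℕ)
    (hfin : ∫⁻ t in Ioo 0 (δ * N + (c + δ)), φ t ≠ ∞) :
    ∑ n ∈ Finset.range N, (∫⁻ τ in Ioo 0 c, φ (δ * (n + 1) + τ)).toReal ≤
      (c + δ) / δ * ((δ * N + (c + δ)) *
        timeMean (fun t => (φ t).toReal) (δ * N + (c + δ))) := by
  set T := δ * N + (c + δ) with hT
  have hT0 : 0 < T := by positivity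
  have hmain := mul_sum_lintegral_window_le hφ c hδ N
  have hRfin : ENNReal.ofReal (c + δ) * ∫⁻ t in Ioo 0 T, φ t ≠ ∞ :=
    ENNReal.mul_ne_top ENNReal.ofReal_ne_top hfin
  have hLfin : ENNReal.ofReal δ * ∑ n ∈ Finset.range N, ∫⁻ τ in Ioo 0 c, φ (δ * (n + 1) + τ) ≠ ∞ :=
    ne_top_of_le_ne_top hRfin hmain
  have hSfin : ∑ n ∈ Finset.range N, ∫⁻ τ in Ioo 0 c, φ (δ * (n + 1) + τ) < ∞ :=
    ENNReal.lt_top_of_mul_ne_top_right hLfin (by simpa using hδ)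
  have hXfin : ∀ n ∈ Finset.range N, ∫⁻ τ in Ioo 0 c, φ (δ * (n + 1) + τ) ≠ ∞ := fun n hn =>
    ((Finset.single_le_sum (fun _ _ => zero_le) hn).trans_lt hSfin).ne
  -- the real form of `hmain`
  have h1 : δ * ∑ n ∈ Finset.range N, (∫⁻ τ in Ioo 0 c, φ (δ * (n + 1) + τ)).toReal ≤
      (c + δ) * (∫⁻ t in Ioo 0 T, φ t).toReal := by
    have h := ENNReal.toReal_mono hRfin hmain
    rwa [ENNReal.toReal_mul, ENNReal.toReal_mul, ENNReal.toReal_ofReal hδ.le,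
      ENNReal.toReal_ofReal (by linarith), ENNReal.toReal_sum hXfin] at h
  -- the lower integral as a running mean
  have h2 : (∫⁻ t in Ioo 0 T, φ t).toReal = T * timeMean (fun t => (φ t).toReal) T := by
    have hφm : AEMeasurable φ (volume.restrict (Ioo 0 T)) :=
      hφ.mono_measure (Measure.restrict_mono Ioo_subset_Ioi_self le_rfl)
    rw [← integral_toReal hφm (ae_lt_top' hφm hfin), timeMean,
      intervalIntegral.integral_of_le hT0.le, integral_Ioc_eq_integral_Ioo, ← mul_assoc,
      mul_inv_cancel₀ hT0.ne', one_mul]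
  rw [h2] at h1
  rw [div_mul_eq_mul_div]
  exact (le_div_iff₀' hδ).2 h1

end SlidingWindow

/-! ## Steps 1–3 for one planar Leray–Hopf solution -/

section PerSolution

variable {ν κ₀ C H L S : ℝ} {g : UnitAddTorus (Fin 2) → EuclideanSpace ℝ (Fin 2)}
  {v₀ : UnitAddTorus (Fin 2) → EuclideanSpace ℝ (Fin 2)}
  {v : ℝ → UnitAddTorus (Fin 2) → EuclideanSpace ℝ (Fin 2)} {h : UnitAddTorus (Fin 2) → ℝ}

/-- **Steps 1–3 — one drift, grid releases.** Under the engine bound (S4 on `T²`: constants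
`κ₀ < 1`, `C ≥ 0` for the profile bounds `H, L` and the maximal window `S + 1`), for a global
Leray–Hopf drift `v` with smooth mean-zero steady force `g`, viscosity `0 < ν ≤ κ₀`, a mesh `δ > 0`
and weak releases `ϑ n` of `h` at the grid times `s_n = δ(n+1)` into `v(s_n + ·)` on `[0, S+1)`:
`limsup_N N⁻¹ Σ_{n<N} (ν∫₀^S‖∇ϑ_n‖²).toReal ≤ (C/log(1/ν)) · (2(S+1+δ)(⟨‖∇v‖₂⟩ + 1) + 1)`,
`⟨‖∇v‖₂⟩ = longTimeAvgSup (t ↦ √((‖∇v(t)‖₂²).toReal))`. Step 1: the per-release bound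
`QuietOfSubLog.toReal_eScalarDissipation_release_le`; Step 2: the discrete sliding window
`sum_toReal_window_le`; Step 3: along `T_N = δN + S + 1 + δ → ∞`, eventually `T_N/N ≤ 2δ` and
`⟨‖∇v‖₂⟩_{T_N} ≤ ⟨‖∇v‖₂⟩ + 1` (bounded running means at fixed `ν`,
`QuietOfSubLog.isBoundedUnder_timeMean_sqrt_eGradNormSq`). [folklore] -/
theorem limsup_cesaro_release_le (hκ₀1 : κ₀ < 1) (hC : 0 ≤ C) (hS : 0 < S)
    (hmain : ∀ (κ T S' : ℝ) (u : ℝ → UnitAddTorus (Fin 2) → EuclideanSpace ℝ (Fin 2))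
        (h' : UnitAddTorus (Fin 2) → ℝ) (θ : ℝ → UnitAddTorus (Fin 2) → ℝ),
        0 < κ → κ ≤ κ₀ → 0 < T → T ≤ S + 1 → 0 ≤ S' →
        (∃ M : ℝ≥0, ∀ᵐ t ∂(volume.restrict (Set.Ioo 0 T)), ∫⁻ x, ‖u t x‖ₑ ^ 2 ≤ M) →
        ∫⁻ t in Set.Ioo 0 T, Torus.eGradNormSq (u t) ^ (1 / 2 : ℝ) ≤ ENNReal.ofReal S' →
        Torus.IsSmooth h' → (∀ x, |h' x| ≤ H) → (∀ x, ‖Torus.gradient h' x‖ ≤ L) →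
        Torus.IsWeakScalarTransportOn T κ u h' θ →
        Torus.eScalarDissipation κ θ 0 T ≤ ENNReal.ofReal (C * (S' + 1) / Real.log κ⁻¹))
    (hν : 0 < ν) (hνκ : ν ≤ κ₀) (hgs : Torus.IsSmooth g) (hgz : Torus.HasZeroMean g)
    (hLH : Torus.IsGlobalLerayHopf ν (fun _ => g) v₀ v)
    (hhs : Torus.IsSmooth h) (hH : ∀ x, |h x| ≤ H) (hL : ∀ x, ‖Torus.gradient h x‖ ≤ L)
    {δ : ℝ} (hδ : 0 < δ) {ϑ : ℕ → ℝ → UnitAddTorus (Fin 2) → ℝ}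
    (hrel : ∀ n : ℕ, Torus.IsWeakScalarTransportOn (S + 1) ν
      (fun τ => v (δ * (n + 1) + τ)) h (ϑ n)) :
    limsup (fun N : ℕ => (N : ℝ)⁻¹ *
        ∑ n ∈ Finset.range N, (Torus.eScalarDissipation ν (ϑ n) 0 S).toReal) atTop ≤
      C / Real.log ν⁻¹ *
        (2 * (S + 1 + δ) * (longTimeAvgSup (fun t => Real.sqrt (Torus.eGradNormSq (v t)).toReal) + 1)
          + 1) := by
  set ℓ := Real.log ν⁻¹ with hℓ
  set φ : ℝ → ℝ≥0∞ := fun t => Torus.eGradNormSq (v t) ^ (1 / 2 : ℝ) with hφ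
  set ψ : ℝ → ℝ := fun t => Real.sqrt (Torus.eGradNormSq (v t)).toReal with hψ
  set Ψ := longTimeAvgSup ψ with hΨ
  set W : ℕ → ℝ := fun n => (∫⁻ τ in Set.Ioo 0 (S + 1), φ (δ * (n + 1) + τ)).toReal with hW
  set D : ℕ → ℝ := fun n => (Torus.eScalarDissipation ν (ϑ n) 0 S).toReal with hD
  have hD0 : ∀ n, 0 ≤ D n := fun n => ENNReal.toReal_nonneg
  have hlog : 0 < ℓ := Real.log_pos ((one_lt_inv₀ hν).2 (hνκ.trans_lt hκ₀1))
  have hCℓ : 0 ≤ C / ℓ := div_nonneg hC hlog.le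
  have hc : (0 : ℝ) < S + 1 := by linarith
  have hφm : AEMeasurable φ (volume.restrict (Set.Ioi 0)) :=
    (aemeasurable_eGradNormSq_Ioi hLH).pow_const _
  have hφψ : (fun t => (φ t).toReal) = ψ := by
    funext t
    simp only [hφ, hψ]
    rw [← ENNReal.toReal_rpow, Real.sqrt_eq_rpow]
  have hψ0 : ∀ t, 0 ≤ ψ t := fun t => Real.sqrt_nonneg _
  -- Step 1: the per-release bound at the grid time `s_n = δ(n+1) > 0`
  have hDW : ∀ n, D n ≤ C / ℓ * (W n + 1) := fun n => by
    have hs : (0 : ℝ) < δ * (n + 1) := by positivity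
    have h1 := toReal_eScalarDissipation_release_le hκ₀1 hC hS hmain hν hνκ hLH hhs hH hL hs (hrel n)
    calc D n ≤ C * (W n + 1) / ℓ := h1
      _ = C / ℓ * (W n + 1) := by ring
  -- Step 3 preliminaries: bounded running means, `T_N → ∞`
  have hbdd : IsBoundedUnder (· ≤ ·) atTop (timeMean ψ) :=
    isBoundedUnder_timeMean_sqrt_eGradNormSq hLH hν (hgs.memLp 2) hgz
  have hδN : Tendsto (fun N : ℕ => δ * (N : ℝ)) atTop atTop :=
    tendsto_natCast_atTop_atTop.const_mul_atTop hδ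
  have hTN : Tendsto (fun N : ℕ => δ * (N : ℝ) + (S + 1 + δ)) atTop atTop :=
    tendsto_atTop_add_const_right _ _ hδN
  have hev1 : ∀ᶠ N : ℕ in atTop, timeMean ψ (δ * N + (S + 1 + δ)) ≤ Ψ + 1 := by
    have h1 : ∀ᶠ T in atTop, timeMean ψ T < Ψ + 1 :=
      eventually_lt_of_limsup_lt (by simp only [hΨ, longTimeAvgSup]; linarith) hbdd
    exact (hTN.eventually h1).mono fun N hN => hN.le
  have hev2 : ∀ᶠ N : ℕ in atTop, S + 1 + δ ≤ δ * N := hδN.eventually_ge_atTop _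
  have hev3 : ∀ᶠ N : ℕ in atTop, 0 < N := eventually_gt_atTop 0
  refine limsup_le_of_le (isCoboundedUnder_le_of_le atTop (x := 0) fun N => ?_) ?_
  · exact mul_nonneg (inv_nonneg.2 (Nat.cast_nonneg _)) (Finset.sum_nonneg fun n _ => hD0 n)
  filter_upwards [hev1, hev2, hev3] with N h1 h2 h3
  have hN : (0 : ℝ) < N := by exact_mod_cast h3
  set T := δ * N + (S + 1 + δ) with hT
  have hT0 : 0 < T := by positivity
  -- Step 1 summed: `Σ D ≤ (C/ℓ)(Σ W + N)`
  have hsumD : ∑ n ∈ Finset.range N, D n ≤ C / ℓ * (∑ n ∈ Finset.range N, W n + N) := by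
    calc ∑ n ∈ Finset.range N, D n
        ≤ ∑ n ∈ Finset.range N, C / ℓ * (W n + 1) := Finset.sum_le_sum fun n _ => hDW n
      _ = C / ℓ * (∑ n ∈ Finset.range N, W n + N) := by
          rw [← Finset.mul_sum, Finset.sum_add_distrib, Finset.sum_const, Finset.card_range,
            nsmul_eq_mul, mul_one]
  -- Step 2: the discrete sliding window
  have hfin : ∫⁻ t in Set.Ioo 0 (δ * N + (S + 1 + δ)), φ t ≠ ∞ :=
    (lintegral_rpow_half_eGradNormSq_lt_top hLH hT0).ne
  have hsumW : ∑ n ∈ Finset.range N, W n ≤ (S + 1 + δ) / δ * (T * timeMean ψ T) := by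
    have h := sum_toReal_window_le hφm hc.le hδ N hfin
    rw [hφψ] at h
    exact h
  -- Step 3: the Cesàro mean of the window strains
  have hmeanW : (N : ℝ)⁻¹ * ∑ n ∈ Finset.range N, W n ≤ 2 * (S + 1 + δ) * (Ψ + 1) := by
    have hm0 : 0 ≤ timeMean ψ T := timeMean_nonneg hψ0 hT0.le
    have hratio : (N : ℝ)⁻¹ * T ≤ 2 * δ := by
      rw [inv_mul_le_iff₀ hN]
      simp only [hT]
      linarith
    calc (N : ℝ)⁻¹ * ∑ n ∈ Finset.range N, W n
        ≤ (N : ℝ)⁻¹ * ((S + 1 + δ) / δ * (T * timeMean ψ T)) :=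
          mul_le_mul_of_nonneg_left hsumW (inv_nonneg.2 hN.le)
      _ = (S + 1 + δ) / δ * ((N : ℝ)⁻¹ * T * timeMean ψ T) := by ring
      _ ≤ (S + 1 + δ) / δ * (2 * δ * (Ψ + 1)) :=
          mul_le_mul_of_nonneg_left (mul_le_mul hratio h1 hm0 (by positivity)) (by positivity)
      _ = 2 * (S + 1 + δ) * (Ψ + 1) := by
          field_simp
  calc (N : ℝ)⁻¹ * ∑ n ∈ Finset.range N, D n
      ≤ (N : ℝ)⁻¹ * (C / ℓ * (∑ n ∈ Finset.range N, W n + N)) :=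
        mul_le_mul_of_nonneg_left hsumD (inv_nonneg.2 hN.le)
    _ = C / ℓ * ((N : ℝ)⁻¹ * ∑ n ∈ Finset.range N, W n + 1) := by
        field_simp
    _ ≤ C / ℓ * (2 * (S + 1 + δ) * (Ψ + 1) + 1) :=
        mul_le_mul_of_nonneg_left (by linarith [hmeanW]) hCℓ

end PerSolution

/-! ## Step 4 — the stub -/

/-- **S5' `stub_quietOfSubLogGrid` — below `o(log(1/ν))` mean planar strain, grid releases are
finite-window quiet.** HYPOTHESES: the release bound of S4 (instantiated on `T²`); a smooth
divergence-free mean-zero steady `g`; `ν_j → 0`; global Leray–Hopf `v_j` (force `g`) with bounded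
mean energy whose limsup-mean strain is sub-logarithmic, `⟨‖∇v_j‖_{L²}⟩/log(1/ν_j) → 0`.
CONCLUSION: for every smooth mean-zero `h`, every window `S > 0`, every mesh `δ > 0` and every
family of weak releases `ϑ j n` of `h` at the grid times `s_n = δ(n+1)` into `v_j` (weak on
`[0,S+1)`), the `limsup` over `N` of the discrete Cesàro means `N⁻¹ Σ_{n<N}` of the age-`S`
dissipation tends to `0` as `j → ∞`. Proof: `H = sup|h|`, `L = sup‖∇h‖` (continuous on the compact
torus), `T₀ = S + 1`; for `j` large `ν_j ≤ κ₀` and `limsup_cesaro_release_le` bounds the `j`-th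
`limsup` by `(C/log(1/ν_j))(2(S+1+δ)(Ψ_j + 1) + 1) → 0` (`Ψ_j/log(1/ν_j) → 0` by hypothesis,
`1/log(1/ν_j) → 0` because `ν_j → 0⁺`); squeeze with the nonnegativity of the Cesàro means. The
energy ceiling and `div g = 0` are not used at this step (they feed S6). [folklore] -/
theorem stub_quietOfSubLogGrid :
    (∀ (H L T₀ : ℝ), 0 < T₀ →
      ∃ κ₀ C : ℝ, 0 < κ₀ ∧ κ₀ < 1 ∧ 0 ≤ C ∧
        ∀ (κ T S : ℝ) (u : ℝ → UnitAddTorus (Fin 2) → EuclideanSpace ℝ (Fin 2))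
          (h : UnitAddTorus (Fin 2) → ℝ) (θ : ℝ → UnitAddTorus (Fin 2) → ℝ),
          0 < κ → κ ≤ κ₀ → 0 < T → T ≤ T₀ → 0 ≤ S →
          (∃ M : ℝ≥0, ∀ᵐ t ∂(volume.restrict (Set.Ioo 0 T)), ∫⁻ x, ‖u t x‖ₑ ^ 2 ≤ M) →
          ∫⁻ t in Set.Ioo 0 T, Torus.eGradNormSq (u t) ^ (1 / 2 : ℝ) ≤ ENNReal.ofReal S →
          Torus.IsSmooth h → (∀ x, |h x| ≤ H) → (∀ x, ‖Torus.gradient h x‖ ≤ L) →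
          Torus.IsWeakScalarTransportOn T κ u h θ →
          Torus.eScalarDissipation κ θ 0 T ≤ ENNReal.ofReal (C * (S + 1) / Real.log κ⁻¹)) →
    ∀ g : UnitAddTorus (Fin 2) → EuclideanSpace ℝ (Fin 2),
      Torus.IsSmooth g → Torus.IsDivFree g → Torus.HasZeroMean g →
      ∀ (ν : ℕ → ℝ) (v₀ : ℕ → UnitAddTorus (Fin 2) → EuclideanSpace ℝ (Fin 2))
        (v : ℕ → ℝ → UnitAddTorus (Fin 2) → EuclideanSpace ℝ (Fin 2)),
        (∀ j, 0 < ν j) → Tendsto ν atTop (𝓝 0) →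
        (∀ j, Torus.IsGlobalLerayHopf (ν j) (fun _ => g) (v₀ j) (v j)) →
        (∃ E : ℝ, ∀ j, meanEnergy (v j) ≤ E) →
        Tendsto (fun j => longTimeAvgSup (fun t => Real.sqrt (Torus.eGradNormSq (v j t)).toReal) /
          Real.log (ν j)⁻¹) atTop (𝓝 0) →
        ∀ h : UnitAddTorus (Fin 2) → ℝ, Torus.IsSmooth h → Torus.HasZeroMean h →
        ∀ S δ : ℝ, 0 < S → 0 < δ → ∀ ϑ : ℕ → ℕ → ℝ → UnitAddTorus (Fin 2) → ℝ,
          (∀ (j n : ℕ), Torus.IsWeakScalarTransportOn (S + 1) (ν j)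
              (fun τ => v j (δ * (n + 1) + τ)) h (ϑ j n)) →
          Tendsto (fun j => limsup (fun N : ℕ => (N : ℝ)⁻¹ *
              ∑ n ∈ Finset.range N, (Torus.eScalarDissipation (ν j) (ϑ j n) 0 S).toReal) atTop)
            atTop (𝓝 0) := by
  intro hEngine g hgs _hgd hgz ν v₀ v hν hν0 hLH _hE hsub h hhs _hhz S δ hS hδ ϑ hrel
  -- sup-norm bounds of the profile on the compact torus
  obtain ⟨H, hH⟩ : ∃ H : ℝ, ∀ x, |h x| ≤ H := by
    obtain ⟨H, hH⟩ :=
      hhs.continuous.bounded_above_of_compact_support (HasCompactSupport.of_compactSpace h)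
    exact ⟨H, fun x => (Real.norm_eq_abs (h x)) ▸ hH x⟩
  obtain ⟨L, hL⟩ : ∃ L : ℝ, ∀ x, ‖Torus.gradient h x‖ ≤ L :=
    hhs.gradient.continuous.bounded_above_of_compact_support (HasCompactSupport.of_compactSpace _)
  -- the engine constants for the maximal window `T₀ = S + 1`
  obtain ⟨κ₀, C, hκ₀, hκ₀1, hC, hmain⟩ := hEngine H L (S + 1) (by linarith)
  -- notation: `ℓ j = log(1/ν_j)`, `Ψ j = ⟨‖∇v_j‖₂⟩`, the bound `R j`
  set ℓ : ℕ → ℝ := fun j => Real.log (ν j)⁻¹ with hℓ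
  set Ψ : ℕ → ℝ := fun j =>
    longTimeAvgSup (fun t => Real.sqrt (Torus.eGradNormSq (v j t)).toReal) with hΨ
  set R : ℕ → ℝ := fun j => C / ℓ j * (2 * (S + 1 + δ) * (Ψ j + 1) + 1) with hR
  -- `1/ℓ_j → 0` and `Ψ_j/ℓ_j → 0`, hence `R_j → 0`
  have hν0' : Tendsto ν atTop (𝓝[>] 0) :=
    tendsto_nhdsWithin_iff.2 ⟨hν0, Eventually.of_forall fun j => hν j⟩
  have hℓtop : Tendsto ℓ atTop atTop :=
    Real.tendsto_log_atTop.comp (tendsto_inv_nhdsGT_zero.comp hν0')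
  have hℓinv : Tendsto (fun j => (ℓ j)⁻¹) atTop (𝓝 0) := tendsto_inv_atTop_zero.comp hℓtop
  have hΨℓ : Tendsto (fun j => Ψ j / ℓ j) atTop (𝓝 0) := hsub
  have hRt : Tendsto R atTop (𝓝 0) := by
    have h1 : Tendsto (fun j => C * (2 * (S + 1 + δ) * (Ψ j / ℓ j) +
        (2 * (S + 1 + δ) + 1) * (ℓ j)⁻¹)) atTop
        (𝓝 (C * (2 * (S + 1 + δ) * 0 + (2 * (S + 1 + δ) + 1) * 0))) :=
      ((hΨℓ.const_mul _).add (hℓinv.const_mul _)).const_mul C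
    rw [mul_zero, mul_zero, add_zero, mul_zero] at h1
    refine h1.congr fun j => ?_
    simp only [hR]
    ring
  -- eventually `ν_j ≤ κ₀`, and then the per-drift bound applies
  have hevκ : ∀ᶠ j in atTop, ν j ≤ κ₀ := hν0.eventually_le_const hκ₀
  refine squeeze_zero' (Eventually.of_forall fun j =>
    limsup_nonneg_of_eventually_nonneg (Eventually.of_forall fun N => ?_)) ?_ hRt
  · exact mul_nonneg (inv_nonneg.2 (Nat.cast_nonneg _))
      (Finset.sum_nonneg fun n _ => ENNReal.toReal_nonneg)
  filter_upwards [hevκ] with j hj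
  exact limsup_cesaro_release_le hκ₀1 hC hS hmain (hν j) hj hgs hgz (hLH j) hhs hH hL hδ
    (fun n => hrel j n)

end Summit.AnomalousDissipation.AnomalousDissipation.Theorems.TwohalfdNeg.QuietOfSubLogGrid
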